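import Summits.ResolutionOfSingularities.ResolutionOfSingularities.Theorems.HilbertSamuelEliminationSigmaMaxModificationsCorridor3WLadderIsoTowerQuadraticTransforms
import HarnessLib

/-!
# [OURS · L1 W4.2] DEFINITIONS: the CANONICAL EMBEDDINGS of all stalks of all stages of an integral tower of blow-ups into the function field of
# the bottom stage, and «a valuation ring DOMINATES the tower»

Crux chain w42 (`SigmaMaxModifications`, stmt-ResolutionOfSingularities-18506; conjunct `SigmaMaxModificationsCorridor3`, stmt-…-19249),
line `w_ladder`, kernel rows `stub_isoSepRecurrent` / `stub_isoInsepTower` of skeleton v8.8. Lead res-L1-w42-lead-1 (gen 6). DEFINITIONS FILE of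
the kernel census (valuative classification of hypothetical infinite isolated point towers): it names the objects every census slice quantifies over,
so that slices can be STATED («for every valuation ring dominating the tower …») instead of hiding the embeddings in an `∃`. `--supports
stmt-ResolutionOfSingularities-19249`; no named fact; nothing here is a statement of any manuscript.

WHAT IS DEFINED / PROVED.
* `towerFieldMap T hint n : K(X_n) →+* K(X_0)` — the composite of the canonical embeddings `ε_{η_{i+1}} : K(X_{i+1}) = 𝒪_{X_{i+1},η} ↪ K(X_i)`
  (`IsBlowup.stalkEmb` at the generic point; Literature `BlowupStalkEmbedding.lean`) down the tower.
* `towerStalkEmb T hint n y : 𝒪_{X_n,y} →+* K(X_0)` — `towerFieldMap ∘ (𝒪_{X_n,y} ⊆ K(X_n))`; THE canonical reading of every stalk of every stage in one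
  field. Proved: injective (`towerStalkEmb_injective`), compatible with the stalk maps of the blow-ups (`towerStalkEmb_comp_stalkMap`:
  `Θ_{n+1,y'} ∘ π_n^♯ = Θ_{n,π_n y'}`) and with specialization (`towerStalkEmb_comp_stalkSpecializes`); at stage `0` it is `(𝒪_{X_0,y} ⊆ K(X_0))`
  (`towerStalkEmb_zero`); the gen-5-style compatibility along marked points (`towerStalkEmb_comp_stalkMap_pt`).
* `DominatesTower T hint pt O` — the valuation ring `O` of `K(X_0)` DOMINATES THE TOWER at the marked points `pt`: it dominates every
  `Θ_n(𝒪_{X_n,pt n})` (equivalently: the centre of `O` on `X_n` is `pt n` for every `n`). Proved: such an `O` exists for every point tower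
  (`exists_dominatesTower`, Chevalley, via gen 5's `exists_valuation_forall_isQuadraticTransformAlong_of_pointTower`).

HONEST FRAMING. OURS vocabulary over folklore blow-up algebra ([Kollar2007] §1.4; [Cutkosky2014] §2.1–2.2; Chevalley [Matsumura1987] Thm. 10.2); NOT
statements of H. Hironaka's manuscript [Hironaka2017] nor of [CossartJannsenSaito2020] / [CossartPiltant2009]. AI-written; AI review is weaker than expert
review.
-/

noncomputable section

set_option linter.dupNamespace false

open IsLocalRing AlgebraicGeometry CategoryTheory TopologicalSpace
open Literature.AlgebraicGeometry.Resolution Literature.AlgebraicGeometry.CossartJannsenSaito2020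

namespace Summit.ResolutionOfSingularities.ResolutionOfSingularities.Cruxes.SigmaMaxModifications.IdeasL1C5

universe u

variable (T : BlowupTower.{u}) (hint : ∀ n, IsIntegral (T.X n))

/-- [OURS · L1 W4.2] **The canonical field map `K(X_n) → K(X_0)` down an integral tower of blow-ups**: `F_0 = id`, `F_{n+1} = F_n ∘ ε_{η_{n+1}}` with
`ε` the canonical embedding of the blown-up stalk at the generic point (`IsBlowup.stalkEmb`; `K(X_{n+1}) = 𝒪_{X_{n+1},η}` by definition).
[cite: Kollar2007, §1.4] -/
def towerFieldMap : ∀ n, (T.X n).functionField →+* (T.X 0).functionField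
  | 0 => RingHom.id _
  | n + 1 =>
    haveI := hint n
    haveI := T.ln n
    (towerFieldMap n).comp ((T.isBlowup n).stalkEmb (genericPoint (T.X (n + 1))))

/-- [OURS · L1 W4.2] **The canonical embedding `Θ_{n,y} : 𝒪_{X_n,y} → K(X_0)`** of the stalk of stage `n` at ANY point `y`:
`towerFieldMap ∘ (𝒪_{X_n,y} ⊆ K(X_n))`. [cite: Kollar2007, §1.4] [cite: Cutkosky2014, §2.1] -/
def towerStalkEmb (n : ℕ) (y : T.X n) : (T.X n).presheaf.stalk y →+* (T.X 0).functionField :=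
  haveI := hint n
  (towerFieldMap T hint n).comp (algebraMap ((T.X n).presheaf.stalk y) (T.X n).functionField)

/-- The recursion step of `towerFieldMap`. [folklore] -/
theorem towerFieldMap_succ (n : ℕ) :
    towerFieldMap T hint (n + 1) =
      (haveI := hint n; haveI := T.ln n; (towerFieldMap T hint n).comp ((T.isBlowup n).stalkEmb (genericPoint (T.X (n + 1))))) :=
  rfl

/-- At stage `0` the canonical embedding is the inclusion `𝒪_{X_0,y} ⊆ K(X_0)`. [folklore] -/
theorem towerStalkEmb_zero (y : T.X 0) :
    towerStalkEmb T hint 0 y = (haveI := hint 0; algebraMap ((T.X 0).presheaf.stalk y) (T.X 0).functionField) :=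
  rfl

/-- The canonical embeddings are injective. [folklore] -/
theorem towerStalkEmb_injective (n : ℕ) (y : T.X n) : Function.Injective (towerStalkEmb T hint n y) := by
  haveI := hint n
  exact (towerFieldMap T hint n).injective.comp (IsFractionRing.injective ((T.X n).presheaf.stalk y) (T.X n).functionField)

/-- **Compatibility with the blow-ups**: `Θ_{n+1,y'} ∘ π_n^♯ = Θ_{n, π_n y'}`. [cite: Kollar2007, §1.4] -/
theorem towerStalkEmb_comp_stalkMap (n : ℕ) (y' : T.X (n + 1)) :
    (towerStalkEmb T hint (n + 1) y').comp ((T.π n).stalkMap y').hom = towerStalkEmb T hint n ((T.π n).base y') := by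
  haveI := hint
  haveI := fun n => T.ln n
  change ((towerFieldMap T hint (n + 1)).comp _).comp _ = (towerFieldMap T hint n).comp _
  rw [towerFieldMap_succ, RingHom.comp_assoc, RingHom.comp_assoc]
  congr 1
  have hε : ((T.isBlowup n).stalkEmb (genericPoint (T.X (n + 1)))).comp
      (algebraMap ((T.X (n + 1)).presheaf.stalk y') (T.X (n + 1)).functionField) = (T.isBlowup n).stalkEmb y' :=
    (T.isBlowup n).stalkEmb_comp_stalkSpecializes ((genericPoint_spec (T.X (n + 1))).specializes trivial)
  rw [← RingHom.comp_assoc, hε, (T.isBlowup n).stalkEmb_comp_stalkMap]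

/-- **Compatibility with specialization**: `Θ_{n,y} ∘ (𝒪_{X_n,z} → 𝒪_{X_n,y}) = Θ_{n,z}` for `y ⤳ z`. [folklore] -/
theorem towerStalkEmb_comp_stalkSpecializes (n : ℕ) {y z : T.X n} (h : y ⤳ z) :
    (towerStalkEmb T hint n y).comp ((T.X n).presheaf.stalkSpecializes h).hom = towerStalkEmb T hint n z := by
  haveI := hint
  change ((towerFieldMap T hint n).comp _).comp _ = (towerFieldMap T hint n).comp _
  rw [RingHom.comp_assoc, algebraMap_comp_stalkSpecializes h]

/-- The canonical embeddings at MARKED points `pt (n+1) ↦ pt n`, in the form consumed by gen 5's tower lemmas (`subringDominates_range_succ`,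
`exists_valuation_forall_isQuadraticTransformAlong_of_pointTower`): `Θ_{n+1,pt(n+1)} ∘ π_n^♯ = Θ_{n,pt n} ∘ (stalk transport along π_n (pt (n+1)) = pt n)`.
[folklore] -/
theorem towerStalkEmb_comp_stalkMap_pt {pt : ∀ n, T.X n} (hpt : ∀ n, (T.π n).base (pt (n + 1)) = pt n) (n : ℕ) :
    (towerStalkEmb T hint (n + 1) (pt (n + 1))).comp ((T.π n).stalkMap (pt (n + 1))).hom =
      (towerStalkEmb T hint n (pt n)).comp ((T.X n).presheaf.stalkCongr (.of_eq (hpt n))).hom.hom := by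
  rw [towerStalkEmb_comp_stalkMap, TopCat.Presheaf.stalkCongr_hom]
  exact (towerStalkEmb_comp_stalkSpecializes T hint n (Inseparable.of_eq (hpt n)).ge).symm

/-- [OURS · L1 W4.2] **A valuation ring of `K(X_0)` DOMINATES THE TOWER at the marked points `pt`**: it dominates (Cutkosky §2.1) the canonical
image of every stalk `𝒪_{X_n, pt n}` — i.e. the centre of `O` on `X_n` is `pt n` for all `n`. The object every slice of the valuative kernel census
quantifies over. [cite: Cutkosky2014, §2.1, §2.2] -/
def DominatesTower (pt : ∀ n, T.X n) (O : ValuationSubring (T.X 0).functionField) : Prop :=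
  ∀ n, SubringDominates (towerStalkEmb T hint n (pt n)).range O.toSubring

/-- **Every point tower is dominated by some valuation ring** (Chevalley along the dominating chain of canonical images; gen 5's
`exists_valuation_forall_isQuadraticTransformAlong_of_pointTower`), and along it every step is the quadratic transform.
[cite: Matsumura1987, Thm. 10.2] [cite: Cutkosky2014, §2.2] -/
theorem exists_dominatesTower {pt : ∀ n, T.X n} (hC : ∀ n, T.C n = {pt n}) (hpt : ∀ n, (T.π n).base (pt (n + 1)) = pt n)
    (hcl : ∀ n, IsClosed ({pt n} : Set (T.X n))) :
    ∃ O : ValuationSubring (T.X 0).functionField, DominatesTower T hint pt O ∧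
      ∀ n, IsQuadraticTransformAlong O (towerStalkEmb T hint n (pt n)).range (towerStalkEmb T hint (n + 1) (pt (n + 1))).range :=
  exists_valuation_forall_isQuadraticTransformAlong_of_pointTower hpt (fun n => towerStalkEmb T hint n (pt n)) hint hC hcl
    (fun n => towerStalkEmb_injective T hint n _) (towerStalkEmb_comp_stalkMap_pt T hint hpt)

end Summit.ResolutionOfSingularities.ResolutionOfSingularities.Cruxes.SigmaMaxModifications.IdeasL1C5

end
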